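import Summits.QuantumFields.BalabanUV.Beta.SecondOrderBorderGauge

/-!
# `BalabanUV.Beta.SecondOrderBorderCocycle` — binder row D1, (L4): COMMUTING AXIS REFLECTIONS, THE COCYCLE (COMMUTATION) IDENTITY OF THE
# CANONICAL CONTACTS, THE BORDER PROJECTION, AND THE SEQUENTIAL MULTI-AXIS SOLUTION STEP (β sub-cell, row BETA-an2 = BINDER-OWNERS row D1 OWNER,
# lineage an2 gen 20, K-L2 part 1; generic `d`, any blocking `N`)

HONEST FRAMING (cell charter, verbatim): «discharging BetaPertH makes Balaban's UV stability UNCONDITIONAL — a real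
constructive-QFT result; it is NOT the continuum limit and NOT the Clay problem.»  Neutral kernel algebra ([folklore]), entrywise; no statement
of Bałaban's papers, no `[cite:]`, no `Prop` fact; instantiates no binder of the wall.  NOT D1, NOT `BetaPertH`, NOT continuum, NOT Clay.

WHAT.  K-L1 (`SecondOrderBorderGauge`) turned the END's border letter into `actB_α T − T = D_α` and solved ONE axis (`T := −½•D_α` when
`actB_α D_α = −D_α`).  ONE table for ALL axes needs the reflections to commute and the contacts to form a COCYCLE
(`D_α + actB_α D_{α′} = D_{α′} + actB_{α′} D_α`); then the sequential step `T ↦ ½(T + actB_{α′} T) − ½ D_{α′}` adds axis `α′` WITHOUT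
destroying the axes already solved.
* §1 `bref_comm`, `mref_comm`, `refK_comm`, **`actB_comm`**: the axis reflections of `ResolventReflection` commute (on sites, legs, kernels, bi-tables).
* §2 `stepB N α D T := ½•(T + actB N α T) − ½•D`; **`stepB_solves_self`** (`actB_α D = −D ⇒` the step solves axis `α`) and
  **`stepB_solves_other`** (if `T` solves axis `β` and the pair `(α, β)` satisfies the cocycle identity, the step still solves axis `β`).
* §3 the BORDER PROJECTION `bd` / `bdB` (keep the `fm`/`mf` blocks): commutes with `refK`/`actB`/`stepB`; border-anti-twin tables stay
  anti-twin under `actB` and `stepB` (`antiTwin_actB`, `antiTwin_stepB`).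
* §4 **`comm_canonD_of_laws`**: for a first-order datum `(𝕄, S)` with the laws of BOTH axes in action form, generators `g^α`, `g^{α′}` that are
  EVEN under the other axis, and `𝕄` `refK`-invariant at the leg pair `(a, b)` under both axes, the canonical contacts satisfy the cocycle
  identity at `(a, b)`: `(D_α + actB_α D_{α′}) =ab= (D_{α′} + actB_{α′} D_α)` — by the gauge form the two sides differ by
  `(𝕄 − refK_{α′}𝕄)·Δg^αΔg′^α − (𝕄 − refK_α𝕄)·Δg^{α′}Δg′^{α′}`.
NOT HERE (K-L2 part 2, `SecondOrderBorderModel`): the wall instance (border invariance of `bhKAt`, the four-axis table, the END's (hBe) at level 0).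
Provenance: β sub-cell, unit beta-an2 gen 20, 2026-08-20 (v1); no existing file touched.
-/

open Finset
open scoped BigOperators
open Literature.MathematicalPhysics.QuantumFieldTheory
open Literature.MathematicalPhysics.QuantumFieldTheory.Balaban1983to89
open Literature.MathematicalPhysics.QuantumFieldTheory.Balaban1983to89.Beta
open ExpKernelCalculus (MKer)
open PolarizationSign (reflSign)
open KernelReflection (LegMap refK refK_apply)
open ResolventReflection (sref bref bref_bref bref_apply mref mref_mref Φ Φ_r_inl Φ_r_inr Φ_s_inl Φ_s_inr reflSign_mul_self
  reflSign_self reflSign_of_ne)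
open OneStepResolventKernel (Fib)
open Summit.QuantumFields.BalabanUV.Beta.TameKernelCalculus
open Summit.QuantumFields.BalabanUV.Beta.ChartConjugation (conjV conjW)
open Summit.QuantumFields.BalabanUV.Beta.BorderedHessian (diagK diagK_apply conjV_diagK_apply)
open Summit.QuantumFields.BalabanUV.Beta.E3LevelOneReflection (refK_add refK_smul refK_sub refK_Φ_refK_Φ Φ_r_r)
open Summit.QuantumFields.BalabanUV.Beta.VertexReflectionContact (refK_neg smul_diagK)
open Summit.QuantumFields.BalabanUV.Beta.SecondOrderBorderGauge

namespace Summit.QuantumFields.BalabanUV.Beta.SecondOrderBorderCocycle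

noncomputable section

variable {d : ℕ}

/-! ## §1 The axis reflections commute -/

/-- [folklore] Bond base-point reflections of two axes commute. -/
theorem bref_comm (α α' κ : Fin (d + 1)) (x : Fin (d + 1) → ℤ) : bref α κ (bref α' κ x) = bref α' κ (bref α κ x) := by
  by_cases hαα : α = α'
  · rw [hαα]
  funext i
  simp only [bref_apply]
  by_cases hi : i = α
  · have hi' : i ≠ α' := fun h => hαα (hi ▸ h)
    simp [hi, hαα]
  · by_cases hi' : i = α'
    · have hne : α' ≠ α := fun h => hαα h.symm
      simp [hi', hne]
    · simp [hi, hi']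

/-- [folklore] Multiplier-leg reflections of two axes commute. -/
theorem mref_comm (N : ℕ) (α α' κ : Fin (d + 1)) (u : Fin (d + 1) → ℤ) : mref N α κ (mref N α' κ u) = mref N α' κ (mref N α κ u) := by
  by_cases hαα : α = α'
  · rw [hαα]
  funext i
  simp only [ResolventReflection.mref]
  by_cases hi : i = α
  · have hi' : i ≠ α' := fun h => hαα (hi ▸ h)
    simp [hi, hαα]
  · by_cases hi' : i = α'
    · have hne : α' ≠ α := fun h => hαα h.symm
      simp [hi', hne]
    · simp [hi, hi']

/-- [folklore] The leg maps of two axis reflections commute. -/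
theorem Φ_r_comm (N : ℕ) (α α' : Fin (d + 1)) (a : Fib d) (x : Fin (d + 1) → ℤ) :
    (Φ (d := d) N α).r a ((Φ (d := d) N α').r a x) = (Φ (d := d) N α').r a ((Φ (d := d) N α).r a x) := by
  cases a with
  | inl κ => rw [Φ_r_inl, Φ_r_inl, Φ_r_inl, Φ_r_inl, bref_comm]
  | inr κ => rw [Φ_r_inr, Φ_r_inr, Φ_r_inr, Φ_r_inr, mref_comm]

/-- [folklore] The kernel relabellings of two axis reflections commute. -/
theorem refK_comm (N : ℕ) (α α' : Fin (d + 1)) (K : MKer (d + 1) (Fib d)) :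
    refK (Φ (d := d) N α) (refK (Φ (d := d) N α') K) = refK (Φ (d := d) N α') (refK (Φ (d := d) N α) K) := by
  funext x z a b
  simp only [refK_apply, Φ_r_comm N α' α]
  ring

/-- [folklore] **THE ACTIONS OF TWO AXIS REFLECTIONS ON BI-TABLES COMMUTE.** -/
theorem actB_comm (N : ℕ) (α α' : Fin (d + 1))
    (F : Fin (d + 1) → (Fin (d + 1) → ℤ) → Fin (d + 1) → (Fin (d + 1) → ℤ) → MKer (d + 1) (Fib d)) :
    actB N α (actB N α' F) = actB N α' (actB N α F) := by
  funext κ u κ' u'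
  show (reflSign α κ * reflSign α κ') • refK (Φ (d := d) N α) ((reflSign α' κ * reflSign α' κ') •
      refK (Φ (d := d) N α') (F κ (bref α' κ (bref α κ u)) κ' (bref α' κ' (bref α κ' u')))) =
    (reflSign α' κ * reflSign α' κ') • refK (Φ (d := d) N α') ((reflSign α κ * reflSign α κ') •
      refK (Φ (d := d) N α) (F κ (bref α κ (bref α' κ u)) κ' (bref α κ' (bref α' κ' u'))))
  rw [refK_smul, refK_smul, smul_smul, smul_smul, mul_comm, bref_comm α' α κ, bref_comm α' α κ', refK_comm]

/-! ## §2 The sequential solution step -/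

/-- [our object] **THE SOLUTION STEP FOR AXIS `α`**: `stepB N α D T := ½•(T + actB N α T) − ½•D` (symmetrise in `α`, then subtract half the contact). -/
def stepB (N : ℕ) (α : Fin (d + 1)) (D T : Fin (d + 1) → (Fin (d + 1) → ℤ) → Fin (d + 1) → (Fin (d + 1) → ℤ) → MKer (d + 1) (Fib d)) :
    Fin (d + 1) → (Fin (d + 1) → ℤ) → Fin (d + 1) → (Fin (d + 1) → ℤ) → MKer (d + 1) (Fib d) :=
  (1 / 2 : ℝ) • (T + actB N α T) - (1 / 2 : ℝ) • D

variable {N : ℕ}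

/-- [folklore] **THE STEP SOLVES ITS OWN AXIS**: `actB_α D = −D ⇒ actB_α (stepB α D T) − stepB α D T = D` (any `T`). -/
theorem stepB_solves_self {α : Fin (d + 1)} {D : Fin (d + 1) → (Fin (d + 1) → ℤ) → Fin (d + 1) → (Fin (d + 1) → ℤ) → MKer (d + 1) (Fib d)}
    (hD : actB N α D = -D) (T : Fin (d + 1) → (Fin (d + 1) → ℤ) → Fin (d + 1) → (Fin (d + 1) → ℤ) → MKer (d + 1) (Fib d)) :
    actB N α (stepB N α D T) - stepB N α D T = D := by
  unfold stepB
  rw [actB_sub, actB_smul, actB_smul, actB_add, actB_actB, hD]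
  module

/-- [folklore] **THE STEP KEEPS THE AXES ALREADY SOLVED**: if `actB_β T − T = D_β` and the cocycle identity `D_α + actB_α D_β = D_β + actB_β D_α`
holds, then `actB_β (stepB α D_α T) − stepB α D_α T = D_β`. -/
theorem stepB_solves_other {α β : Fin (d + 1)}
    {Dα Dβ T : Fin (d + 1) → (Fin (d + 1) → ℤ) → Fin (d + 1) → (Fin (d + 1) → ℤ) → MKer (d + 1) (Fib d)}
    (hT : actB N β T - T = Dβ) (hc : Dα + actB N α Dβ = Dβ + actB N β Dα) :
    actB N β (stepB N α Dα T) - stepB N α Dα T = Dβ := by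
  have h1 : actB N β T = T + Dβ := by rw [← hT]; abel
  have h2 : actB N β (actB N α T) = actB N α T + actB N α Dβ := by rw [actB_comm, h1, actB_add]
  have h3 : actB N α Dβ = Dβ + actB N β Dα - Dα := by rw [← hc]; abel
  unfold stepB
  rw [actB_sub, actB_smul, actB_smul, actB_add, h2, h1, h3]
  module

/-! ## §3 The border projection and the preservation of border anti-twinness -/

/-- [our object] **THE BORDER PROJECTION** of a kernel: keep the field–multiplier and multiplier–field blocks, zero the two diagonal blocks. -/
def bd (K : MKer (d + 1) (Fib d)) : MKer (d + 1) (Fib d) :=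
  fun x z a b =>
    match a, b with
    | Sum.inl _, Sum.inr _ => K x z a b
    | Sum.inr _, Sum.inl _ => K x z a b
    | Sum.inl _, Sum.inl _ => 0
    | Sum.inr _, Sum.inr _ => 0

/-- [our object] The border projection of a bi-table (pointwise in the jet bonds). -/
def bdB (F : Fin (d + 1) → (Fin (d + 1) → ℤ) → Fin (d + 1) → (Fin (d + 1) → ℤ) → MKer (d + 1) (Fib d)) :
    Fin (d + 1) → (Fin (d + 1) → ℤ) → Fin (d + 1) → (Fin (d + 1) → ℤ) → MKer (d + 1) (Fib d) :=
  fun κ u κ' u' => bd (F κ u κ' u')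

section Bd

variable (K : MKer (d + 1) (Fib d)) (x z : Fin (d + 1) → ℤ)

/-- [folklore] `fm` entries of the border projection. -/
@[simp] theorem bd_inl_inr (β m : Fin (d + 1)) : bd K x z (Sum.inl β) (Sum.inr m) = K x z (Sum.inl β) (Sum.inr m) := rfl
/-- [folklore] `mf` entries of the border projection. -/
@[simp] theorem bd_inr_inl (m β : Fin (d + 1)) : bd K x z (Sum.inr m) (Sum.inl β) = K x z (Sum.inr m) (Sum.inl β) := rfl
/-- [folklore] `ff` entries of the border projection vanish. -/
@[simp] theorem bd_inl_inl (β β' : Fin (d + 1)) : bd K x z (Sum.inl β) (Sum.inl β') = 0 := rfl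
/-- [folklore] `mm` entries of the border projection vanish. -/
@[simp] theorem bd_inr_inr (m m' : Fin (d + 1)) : bd K x z (Sum.inr m) (Sum.inr m') = 0 := rfl

end Bd

/-- [folklore] The border projection commutes with leg relabelling (relabelling preserves the block type). -/
theorem refK_bd (Ψ : LegMap (d + 1) (Fib d)) (K : MKer (d + 1) (Fib d)) : refK Ψ (bd K) = bd (refK Ψ K) := by
  funext x z a b
  rcases a with β | m <;> rcases b with β' | m' <;> simp [refK_apply, bd]

/-- [folklore] The border projection commutes with the reflection action on bi-tables. -/
theorem actB_bdB (α : Fin (d + 1)) (F : Fin (d + 1) → (Fin (d + 1) → ℤ) → Fin (d + 1) → (Fin (d + 1) → ℤ) → MKer (d + 1) (Fib d)) :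
    actB N α (bdB F) = bdB (actB N α F) := by
  funext κ u κ' u'
  show (reflSign α κ * reflSign α κ') • refK (Φ (d := d) N α) (bd (F κ (bref α κ u) κ' (bref α κ' u'))) =
    bd ((reflSign α κ * reflSign α κ') • refK (Φ (d := d) N α) (F κ (bref α κ u) κ' (bref α κ' u')))
  rw [refK_bd]
  funext x z a b
  rcases a with β | m <;> rcases b with β' | m' <;> simp [bd]

/-- [folklore] **THE ACTION PRESERVES BORDER ANTI-TWINNESS**: if every `F κ u κ′ u′` is anti-twin on the border, so is every `actB N α F κ u κ′ u′`. -/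
theorem antiTwin_actB (α : Fin (d + 1)) {F : Fin (d + 1) → (Fin (d + 1) → ℤ) → Fin (d + 1) → (Fin (d + 1) → ℤ) → MKer (d + 1) (Fib d)}
    (hF : ∀ κ u κ' u' (x z : Fin (d + 1) → ℤ) (β m : Fin (d + 1)), F κ u κ' u' z x (Sum.inr m) (Sum.inl β) = -F κ u κ' u' x z (Sum.inl β) (Sum.inr m))
    (κ : Fin (d + 1)) (u : Fin (d + 1) → ℤ) (κ' : Fin (d + 1)) (u' x z : Fin (d + 1) → ℤ) (β m : Fin (d + 1)) :
    actB N α F κ u κ' u' z x (Sum.inr m) (Sum.inl β) = -actB N α F κ u κ' u' x z (Sum.inl β) (Sum.inr m) := by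
  rw [actB_apply, actB_apply, hF]
  ring

/-- [folklore] **THE STEP PRESERVES BORDER ANTI-TWINNESS.** -/
theorem antiTwin_stepB (α : Fin (d + 1)) {D T : Fin (d + 1) → (Fin (d + 1) → ℤ) → Fin (d + 1) → (Fin (d + 1) → ℤ) → MKer (d + 1) (Fib d)}
    (hD : ∀ κ u κ' u' (x z : Fin (d + 1) → ℤ) (β m : Fin (d + 1)), D κ u κ' u' z x (Sum.inr m) (Sum.inl β) = -D κ u κ' u' x z (Sum.inl β) (Sum.inr m))
    (hT : ∀ κ u κ' u' (x z : Fin (d + 1) → ℤ) (β m : Fin (d + 1)), T κ u κ' u' z x (Sum.inr m) (Sum.inl β) = -T κ u κ' u' x z (Sum.inl β) (Sum.inr m))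
    (κ : Fin (d + 1)) (u : Fin (d + 1) → ℤ) (κ' : Fin (d + 1)) (u' x z : Fin (d + 1) → ℤ) (β m : Fin (d + 1)) :
    stepB N α D T κ u κ' u' z x (Sum.inr m) (Sum.inl β) = -stepB N α D T κ u κ' u' x z (Sum.inl β) (Sum.inr m) := by
  simp only [stepB, Pi.sub_apply, Pi.add_apply, Pi.smul_apply, smul_eq_mul]
  rw [hD, hT, antiTwin_actB α hT]
  ring

/-- [folklore] **THE STEP PRESERVES VANISHING BLOCKS** (any leg pair `(a, b)`): if `D` and `T` vanish at `(a, b)` everywhere, so does the step. -/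
theorem stepB_apply_eq_zero (α : Fin (d + 1)) {D T : Fin (d + 1) → (Fin (d + 1) → ℤ) → Fin (d + 1) → (Fin (d + 1) → ℤ) → MKer (d + 1) (Fib d)}
    {a b : Fib d} (hD : ∀ κ u κ' u' (x z : Fin (d + 1) → ℤ), D κ u κ' u' x z a b = 0)
    (hT : ∀ κ u κ' u' (x z : Fin (d + 1) → ℤ), T κ u κ' u' x z a b = 0)
    (κ : Fin (d + 1)) (u : Fin (d + 1) → ℤ) (κ' : Fin (d + 1)) (u' x z : Fin (d + 1) → ℤ) :
    stepB N α D T κ u κ' u' x z a b = 0 := by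
  simp only [stepB, Pi.sub_apply, Pi.add_apply, Pi.smul_apply, smul_eq_mul, actB_apply, hD, hT]
  ring

/-- [folklore] The border projection of a bi-table has no field–field block. -/
theorem bdB_inl_inl (F : Fin (d + 1) → (Fin (d + 1) → ℤ) → Fin (d + 1) → (Fin (d + 1) → ℤ) → MKer (d + 1) (Fib d))
    (κ : Fin (d + 1)) (u : Fin (d + 1) → ℤ) (κ' : Fin (d + 1)) (u' x z : Fin (d + 1) → ℤ) (β β' : Fin (d + 1)) :
    bdB F κ u κ' u' x z (Sum.inl β) (Sum.inl β') = 0 := rfl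

/-- [folklore] The border projection of a bi-table has no multiplier–multiplier block. -/
theorem bdB_inr_inr (F : Fin (d + 1) → (Fin (d + 1) → ℤ) → Fin (d + 1) → (Fin (d + 1) → ℤ) → MKer (d + 1) (Fib d))
    (κ : Fin (d + 1)) (u : Fin (d + 1) → ℤ) (κ' : Fin (d + 1)) (u' x z : Fin (d + 1) → ℤ) (m m' : Fin (d + 1)) :
    bdB F κ u κ' u' x z (Sum.inr m) (Sum.inr m') = 0 := rfl

/-- [folklore] The border projection of a bi-table keeps the field–multiplier block. -/
theorem bdB_inl_inr (F : Fin (d + 1) → (Fin (d + 1) → ℤ) → Fin (d + 1) → (Fin (d + 1) → ℤ) → MKer (d + 1) (Fib d))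
    (κ : Fin (d + 1)) (u : Fin (d + 1) → ℤ) (κ' : Fin (d + 1)) (u' x z : Fin (d + 1) → ℤ) (β m : Fin (d + 1)) :
    bdB F κ u κ' u' x z (Sum.inl β) (Sum.inr m) = F κ u κ' u' x z (Sum.inl β) (Sum.inr m) := rfl

/-- [folklore] The border projection of a bi-table keeps the multiplier–field block. -/
theorem bdB_inr_inl (F : Fin (d + 1) → (Fin (d + 1) → ℤ) → Fin (d + 1) → (Fin (d + 1) → ℤ) → MKer (d + 1) (Fib d))
    (κ : Fin (d + 1)) (u : Fin (d + 1) → ℤ) (κ' : Fin (d + 1)) (u' x z : Fin (d + 1) → ℤ) (m β : Fin (d + 1)) :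
    bdB F κ u κ' u' x z (Sum.inr m) (Sum.inl β) = F κ u κ' u' x z (Sum.inr m) (Sum.inl β) := rfl

/-- [folklore] `actB` of a border projection is anti-invariant when the bi-table is (`actB F = −F ⇒ actB (bdB F) = −bdB F`). -/
theorem actB_bdB_of_anti (α : Fin (d + 1)) {F : Fin (d + 1) → (Fin (d + 1) → ℤ) → Fin (d + 1) → (Fin (d + 1) → ℤ) → MKer (d + 1) (Fib d)}
    (hF : actB N α F = -F) : actB N α (bdB F) = -bdB F := by
  rw [actB_bdB, hF]
  funext κ u κ' u' x z a b
  rcases a with β | m <;> rcases b with β' | m' <;> simp [bdB, bd]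

/-! ## §4 The cocycle (commutation) identity of the canonical contacts of two axes -/

section Comm

variable {α α' : Fin (d + 1)} {𝕄 : MKer (d + 1) (Fib d)} {S : Fin (d + 1) → (Fin (d + 1) → ℤ) → MKer (d + 1) (Fib d)}
  {gα gα' : Fin (d + 1) → (Fin (d + 1) → ℤ) → (Fin (d + 1) → ℤ) → Fib d → ℝ}

/-- [folklore] **THE REFLECTED CONTACT, ENTRYWISE** (any leg pair): under the first-order law of axis `α` in action form and a generator family
`g′` that is `α`-EVEN (`g′ κ (bref α κ u) (Φ_α.r b z) b = ε_κ · g′ κ u z b`),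
`actB_α (canonD 𝕄 S g′) =ab= (S′ + 𝕄·Δg^α′)·Δg′ + (S + 𝕄·Δg^α)·Δg′′ + (refK_α 𝕄)·Δg′·Δg′′` — the gauge form with the first-order tables
transported by the `α`-law and `𝕄` relabelled. -/
theorem actB_canonD_apply_of_even (hS : actS N α S = fun κ u => S κ u + conjV 𝕄 (diagK (gα κ u)))
    (hg : ∀ (κ : Fin (d + 1)) (u z : Fin (d + 1) → ℤ) (b : Fib d), gα' κ (bref α κ u) ((Φ (d := d) N α).r b z) b = reflSign α κ * gα' κ u z b)
    (κ : Fin (d + 1)) (u : Fin (d + 1) → ℤ) (κ' : Fin (d + 1)) (u' x z : Fin (d + 1) → ℤ) (a b : Fib d) :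
    actB N α (canonD 𝕄 S gα') κ u κ' u' x z a b =
      (S κ' u' x z a b + 𝕄 x z a b * (gα κ' u' z b - gα κ' u' x a)) * (gα' κ u z b - gα' κ u x a) +
        (S κ u x z a b + 𝕄 x z a b * (gα κ u z b - gα κ u x a)) * (gα' κ' u' z b - gα' κ' u' x a) +
        refK (Φ (d := d) N α) 𝕄 x z a b * ((gα' κ u z b - gα' κ u x a) * (gα' κ' u' z b - gα' κ' u' x a)) := by
  -- the two transported first-order tables
  have e1 := congrFun (congrFun (congrFun (congrFun (congrFun (congrFun hS κ) u) x) z) a) b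
  have e2 := congrFun (congrFun (congrFun (congrFun (congrFun (congrFun hS κ') u') x) z) a) b
  simp only [Pi.add_apply, conjV_diagK_apply, actS_apply] at e1 e2
  rw [actB_apply, canonD_apply, hg κ u, hg κ u, hg κ' u', hg κ' u', refK_apply, ← e1, ← e2]
  have hκ := reflSign_mul_self α κ
  have hκ' := reflSign_mul_self α κ'
  set A := S κ' (bref α κ' u') ((Φ (d := d) N α).r a x) ((Φ (d := d) N α).r b z) a b
  set B := S κ (bref α κ u) ((Φ (d := d) N α).r a x) ((Φ (d := d) N α).r b z) a b
  set M := 𝕄 ((Φ (d := d) N α).r a x) ((Φ (d := d) N α).r b z) a b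
  set q := gα' κ u z b - gα' κ u x a
  set q' := gα' κ' u' z b - gα' κ' u' x a
  linear_combination (reflSign α κ' * ((Φ (d := d) N α).s a * (Φ (d := d) N α).s b) * A * q) * hκ +
    (reflSign α κ * ((Φ (d := d) N α).s a * (Φ (d := d) N α).s b) * B * q') * hκ' +
    ((Φ (d := d) N α).s a * (Φ (d := d) N α).s b * M * q * q' * (reflSign α κ' * reflSign α κ')) * hκ +
    ((Φ (d := d) N α).s a * (Φ (d := d) N α).s b * M * q * q') * hκ'

/-- [folklore] **THE COCYCLE IDENTITY OF THE CANONICAL CONTACTS OF TWO AXES** at a leg pair `(a, b)`: with both first-order laws in action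
form, each generator EVEN under the other axis, and `𝕄` invariant under both relabellings at `(a, b)`,
`canonD^α + actB_α canonD^{α′} =ab= canonD^{α′} + actB_{α′} canonD^α`. -/
theorem comm_canonD_of_laws (hSα : actS N α S = fun κ u => S κ u + conjV 𝕄 (diagK (gα κ u)))
    (hSα' : actS N α' S = fun κ u => S κ u + conjV 𝕄 (diagK (gα' κ u)))
    (hgα' : ∀ (κ : Fin (d + 1)) (u z : Fin (d + 1) → ℤ) (b : Fib d), gα' κ (bref α κ u) ((Φ (d := d) N α).r b z) b = reflSign α κ * gα' κ u z b)
    (hgα : ∀ (κ : Fin (d + 1)) (u z : Fin (d + 1) → ℤ) (b : Fib d), gα κ (bref α' κ u) ((Φ (d := d) N α').r b z) b = reflSign α' κ * gα κ u z b)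
    {a b : Fib d} (h𝕄α : ∀ x z : Fin (d + 1) → ℤ, refK (Φ (d := d) N α) 𝕄 x z a b = 𝕄 x z a b)
    (h𝕄α' : ∀ x z : Fin (d + 1) → ℤ, refK (Φ (d := d) N α') 𝕄 x z a b = 𝕄 x z a b)
    (κ : Fin (d + 1)) (u : Fin (d + 1) → ℤ) (κ' : Fin (d + 1)) (u' x z : Fin (d + 1) → ℤ) :
    (canonD 𝕄 S gα + actB N α (canonD 𝕄 S gα')) κ u κ' u' x z a b = (canonD 𝕄 S gα' + actB N α' (canonD 𝕄 S gα)) κ u κ' u' x z a b := by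
  simp only [Pi.add_apply]
  rw [actB_canonD_apply_of_even hSα hgα', actB_canonD_apply_of_even hSα' hgα, canonD_apply, canonD_apply, h𝕄α, h𝕄α']
  ring

end Comm

end

end Summit.QuantumFields.BalabanUV.Beta.SecondOrderBorderCocycle
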